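import Summits.HodgeConjecture.HodgeConjecture.Theorems.F0P3XiRigid                       -- ★ U♭ `memXiFamily_rigid` (needs an irreducible smooth finite component)
import Summits.HodgeConjecture.HodgeConjecture.Theorems.R90S5HasFinComponentOfDiscrete    -- ★ K2E1-p12: finite components — «AFA» ∕ cuspidal `U(Φ₃)` hypothesis-free ∕ all `P` mod 12R3
import Summits.HodgeConjecture.HodgeConjecture.Theorems.F0LD2AutomorphicFlathAdmissibleOfCompact -- ★ `automorphicFlathAdmissible_of_compactSpace`
import Summits.HodgeConjecture.HodgeConjecture.Theorems.F0P3HolProjectionReduction          -- ★ `compactSpace_automorphicQuotient_cm` (definite off `ι`, `[L⁺:ℚ] ≥ 2` ⇒ compact quotient)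
import HarnessLib

/-!
# R90-TF · S5 «Ch. 13.3» — U♭ ξ-RIGIDITY OF THE ENVELOPE FOR EVERY DISCRETE `P`: `MemXiFamily P … ξ → MemXiFamily P … ξ′ → ξ = ξ′`
# («AFA» ∕ compact inner forms hypothesis-free ∕ cuspidal `U(Φ₃)` hypothesis-free ∕ all `P` of `U(Φ₃)` modulo 12R3)
# (`Theorems/R90S5MemXiFamilyRigid.lean`; seat R90-C133-p03 (g0), self-dealt on the γ line (the ξ of an envelope member is UNIQUE — the `H`-side of Thm. 13.3.5 ∕ p. 244
# «there exists a unique ξ such that the e.v.p.'s t(Π′) and t(Π(ξ)) coincide»), 2026-09-04)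

Cell `hodgecm-mathlib`, crux H413 (`stmt-HodgeConjecture-24833`), route of record `HCCMUnconditional`; programme R90-TF, section S5 (base `R90-C133`).  PROOF lane
(`--supports stmt-HodgeConjecture-24833 --as helper`): theorems only; Lines-free.

★ U♭ `F0P3XiRigid.memXiFamily_rigid` proves ξ-rigidity of the envelope for a discrete `P` WITH an irreducible smooth finite component `σ` (local half: Zelevinsky rigidity of the
split member's labels at one place above every split `v`; global half: weak approximation for `U(1)`), and ★ `F0P3cMemXiFamilyRigidOfCot` discharged `σ` on the COTANGENT locus.  This
file discharges `σ` for EVERY discrete `P` in the four frames the tree now affords (★ K2E1-p12 `R90S5HasFinComponentOfDiscrete`, ★ `automorphicFlathAdmissible_of_compactSpace`):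
* `memXiFamily_rigid_of_hasFinComponent_adm` — irreducible ADMISSIBLE finite component (admissible ⇒ smooth);
* `memXiFamily_rigid_of_automorphicFlathAdmissible` — under ★ NF «AFA» (every discrete `P`);
* `memXiFamily_rigid_of_posDef` — the cell's COMPACT inner forms (`H` definite off `ι`, `[L⁺:ℚ] ≥ 2`): EVERY discrete `P`, HYPOTHESIS-FREE (supersedes the cotangent restriction of ★
  `memXiFamily_rigid_of_isCot` for these frames);
* `memXiFamily_rigid_qs_of_le_cuspidalSubspace` — the quasi-split `U(Φ₃)`, CUSPIDAL `P`, HYPOTHESIS-FREE (GGPS ★); `memXiFamily_rigid_qs_of_residualCompactR` — all `P`, modulo E1's 12R3;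
* `existsUnique_memXiFamily_*` packagings.
Print: the ξ with `π ∈ Π(ξ)` is unique [§14.6 p. 244 «there exists a unique ξ …»; Thm. 13.3.5; Lemma 13.6.3 (b)]; in the tree this is LOCAL (split labels) + weak approximation, no trace formula.
HONEST LABEL: helpers; closes no socket; REL ≠ ★ ≠ BUILT; HC_CM is proved only modulo the 7 printed citations (2 remaining named inputs: hLiu418 = stmt-HodgeConjecture-24832,
h413 = stmt-HodgeConjecture-24833) until rung 0 closes.
[cite: Rogawski1990, §13.1 p. 199; §12.2 pp. 173–174; Thm. 13.3.5 p. 202; §14.6 p. 244] [cite: Zelevinsky1980, Thm. 4.2] [cite: FlathCorvallis1979, Thm. 3] [cite: PlatonovRapinchuk1994, §7.3 Prop. 7.8]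
-/

set_option autoImplicit false
-- the mandated namespace repeats the single-problem summit's segment (`HodgeConjecture.HodgeConjecture`)
set_option linter.dupNamespace false

noncomputable section

open NumberField IsDedekindDomain MeasureTheory
open scoped Matrix ComplexOrder
open Literature.NumberTheory.Rogawski1990 Literature.NumberTheory.GaloisRepresentations
open Literature.NumberTheory.Automorphic Literature.NumberTheory.Automorphic.UnitaryGroup
open Summit.HodgeConjecture.HodgeConjecture.Cruxes.H413

namespace Summit.HodgeConjecture.HodgeConjecture.R90.S5

variable (L : Type) [Field L] [NumberField L] [IsCMField L] (H : Matrix (Fin 3) (Fin 3) L)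
  (hH : (H.map (cmConjRingHom L))ᵀ = H) (hHd : IsUnit H.det)
  (μ : Measure (adelicGroupData (↥(maximalRealSubfield L)) L (IsCMField.complexConj L) 3 H).automorphicQuotient)
  [hμ : (adelicGroupData (↥(maximalRealSubfield L)) L (IsCMField.complexConj L) 3 H).IsAutomorphicMeasure μ]
  (μω : HeckeCharacter L) (hμu : μω.IsUnitary)

/-! ## §1 From an irreducible admissible finite component ∕ «AFA» -/

/-- **U♭ with an irreducible ADMISSIBLE finite component** (admissible ⇒ smooth, ★ `Representation.IsAdmissible.isSmooth`).
[cite: Rogawski1990, §13.1 p. 199; §12.2 pp. 173–174] [cite: Zelevinsky1980, Thm. 4.2] -/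
theorem memXiFamily_rigid_of_hasFinComponent_adm (P : DiscreteAutomorphicRep (adelicGroupData (↥(maximalRealSubfield L)) L (IsCMField.complexConj L) 3 H) μ)
    {W : Type} [AddCommGroup W] [Module ℂ W] {σ : Representation ℂ (finAdelic (↥(maximalRealSubfield L)) L (IsCMField.complexConj L) 3 H) W}
    (hirr : σ.IsIrreducible) (hadm : σ.IsAdmissible) (hP : P.HasFinComponent σ) (ξ ξ' : OneDimAutRepH L)
    (h : MemXiFamily P hH hHd μω hμu ξ) (h' : MemXiFamily P hH hHd μω hμu ξ') : ξ = ξ' :=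
  F0P3XiRigid.memXiFamily_rigid hH hHd P hirr hadm.isSmooth hP μω hμu ξ ξ' h h'

/-- **U♭ FOR EVERY DISCRETE `P` UNDER «AFA»** (★ NF `UnitaryGroup.AutomorphicFlathAdmissible L⁺ L c̄ 3 H μ`: every discrete `P` has an irreducible admissible finite component).
[cite: Rogawski1990, §13.1 p. 199; §14.6 p. 244] [cite: FlathCorvallis1979, Thm. 3] [cite: Zelevinsky1980, Thm. 4.2] -/
theorem memXiFamily_rigid_of_automorphicFlathAdmissible
    (hAF : AutomorphicFlathAdmissible (↥(maximalRealSubfield L)) L (IsCMField.complexConj L) 3 H μ)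
    (P : DiscreteAutomorphicRep (adelicGroupData (↥(maximalRealSubfield L)) L (IsCMField.complexConj L) 3 H) μ) (ξ ξ' : OneDimAutRepH L)
    (h : MemXiFamily P hH hHd μω hμu ξ) (h' : MemXiFamily P hH hHd μω hμu ξ') : ξ = ξ' := by
  obtain ⟨W, _, _, σ, hirr, hadm, hP⟩ := hAF P
  exact memXiFamily_rigid_of_hasFinComponent_adm L H hH hHd μ μω hμu P hirr hadm hP ξ ξ' h h'

/-! ## §2 The cell's compact inner forms: every discrete `P`, hypothesis-free -/

/-- **U♭ FOR EVERY DISCRETE `P` OF A COMPACT INNER FORM — HYPOTHESIS-FREE**: `H` positive definite at every complex place `≠ ι` and `[L⁺:ℚ] ≥ 2` (the letters' frame `hdef h2`) ⇒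
`[U(H)]` compact (★ `compactSpace_automorphicQuotient_cm`) ⇒ «AFA» ★ (`automorphicFlathAdmissible_of_compactSpace`) ⇒ ξ-rigidity of the envelope for EVERY discrete `P` (not only the
cotangent ones of ★ `memXiFamily_rigid_of_isCot`). [cite: Rogawski1990, §13.1 p. 199; §14.2 p. 232; §14.6 p. 244] [cite: FlathCorvallis1979, Thm. 3] [cite: Zelevinsky1980, Thm. 4.2] -/
theorem memXiFamily_rigid_of_posDef (ι : L →+* ℂ) (hdef : ∀ τ' : L →+* ℂ, InfinitePlace.mk τ' ≠ InfinitePlace.mk ι → (H.map τ').PosDef)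
    (h2 : 2 ≤ Module.finrank ℚ ↥(maximalRealSubfield L))
    (P : DiscreteAutomorphicRep (adelicGroupData (↥(maximalRealSubfield L)) L (IsCMField.complexConj L) 3 H) μ) (ξ ξ' : OneDimAutRepH L)
    (h : MemXiFamily P hH hHd μω hμu ξ) (h' : MemXiFamily P hH hHd μω hμu ξ') : ξ = ξ' := by
  haveI := F0P3HolProjectionReduction.compactSpace_automorphicQuotient_cm hdef h2
  exact memXiFamily_rigid_of_automorphicFlathAdmissible L H hH hHd μ μω hμu
    (_root_.Summit.HodgeConjecture.HodgeConjecture.Cruxes.HLiu418.F0LD2AutomorphicFlathAdmissibleOfCompact.automorphicFlathAdmissible_of_compactSpace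
      (↥(maximalRealSubfield L)) L
      (IsCMField.complexConj L) 3 H μ) P ξ ξ' h h'

/-- **`∃!` packaging on a compact inner form**: a discrete `P` in SOME ξ-envelope lies in the envelope of a UNIQUE `ξ`. [cite: Rogawski1990, §14.6 p. 244] -/
theorem existsUnique_memXiFamily_of_posDef (ι : L →+* ℂ) (hdef : ∀ τ' : L →+* ℂ, InfinitePlace.mk τ' ≠ InfinitePlace.mk ι → (H.map τ').PosDef)
    (h2 : 2 ≤ Module.finrank ℚ ↥(maximalRealSubfield L))
    (P : DiscreteAutomorphicRep (adelicGroupData (↥(maximalRealSubfield L)) L (IsCMField.complexConj L) 3 H) μ)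
    (hex : ∃ ξ : OneDimAutRepH L, MemXiFamily P hH hHd μω hμu ξ) : ∃! ξ : OneDimAutRepH L, MemXiFamily P hH hHd μω hμu ξ := by
  obtain ⟨ξ, hξ⟩ := hex
  exact ⟨ξ, hξ, fun ξ' hξ' => memXiFamily_rigid_of_posDef L H hH hHd μ μω hμu ι hdef h2 P ξ' ξ hξ' hξ⟩

/-! ## §3 The quasi-split `U(Φ₃)`: cuspidal `P` hypothesis-free; all `P` modulo 12R3 -/

section QuasiSplit

variable (μq : Measure (adelicGroupData (↥(maximalRealSubfield L)) L (IsCMField.complexConj L) 3 (qsForm L)).automorphicQuotient)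
  [hμq : (adelicGroupData (↥(maximalRealSubfield L)) L (IsCMField.complexConj L) 3 (qsForm L)).IsAutomorphicMeasure μq]
  (hHq : ((qsForm L).map (cmConjRingHom L))ᵀ = qsForm L) (hHdq : IsUnit (qsForm L).det)

/-- **U♭ FOR A CUSPIDAL `P` OF `U(Φ₃)` — HYPOTHESIS-FREE** (`P.space ≤ L²_cusp` along ★ `cmParabolicDataR L 3`; finite component by ★ K2E1-p12
`exists_irreducible_admissible_hasFinComponent_qs_of_le_cuspidalSubspace`, GGPS ★). [cite: Rogawski1990, Thm. 13.3.5 p. 202; §14.6 p. 244] [cite: GelfandGraevPiatetskiShapiro1969, Ch. 3] [cite: Zelevinsky1980, Thm. 4.2] -/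
theorem memXiFamily_rigid_qs_of_le_cuspidalSubspace
    (P : DiscreteAutomorphicRep (adelicGroupData (↥(maximalRealSubfield L)) L (IsCMField.complexConj L) 3 (qsForm L)) μq)
    (hP : P.space ≤ (adelicGroupData (↥(maximalRealSubfield L)) L (IsCMField.complexConj L) 3 (qsForm L)).cuspidalSubspace μq
      (K2E1CuspidalSpectrumUnitary.cmParabolicDataR L 3))
    (ξ ξ' : OneDimAutRepH L) (h : MemXiFamily P hHq hHdq μω hμu ξ) (h' : MemXiFamily P hHq hHdq μω hμu ξ') : ξ = ξ' := by
  obtain ⟨W, _, _, σ, hirr, hadm, hPσ⟩ := exists_irreducible_admissible_hasFinComponent_qs_of_le_cuspidalSubspace L μq P hP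
  exact memXiFamily_rigid_of_hasFinComponent_adm L (qsForm L) hHq hHdq μq μω hμu P hirr hadm hPσ ξ ξ' h h'

/-- **`∃!` packaging for cuspidal `P` of `U(Φ₃)`.** [cite: Rogawski1990, §14.6 p. 244] -/
theorem existsUnique_memXiFamily_qs_of_le_cuspidalSubspace
    (P : DiscreteAutomorphicRep (adelicGroupData (↥(maximalRealSubfield L)) L (IsCMField.complexConj L) 3 (qsForm L)) μq)
    (hP : P.space ≤ (adelicGroupData (↥(maximalRealSubfield L)) L (IsCMField.complexConj L) 3 (qsForm L)).cuspidalSubspace μq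
      (K2E1CuspidalSpectrumUnitary.cmParabolicDataR L 3))
    (hex : ∃ ξ : OneDimAutRepH L, MemXiFamily P hHq hHdq μω hμu ξ) : ∃! ξ : OneDimAutRepH L, MemXiFamily P hHq hHdq μω hμu ξ := by
  obtain ⟨ξ, hξ⟩ := hex
  exact ⟨ξ, hξ, fun ξ' hξ' => memXiFamily_rigid_qs_of_le_cuspidalSubspace L μω hμu μq hHq hHdq P hP ξ' ξ hξ' hξ⟩

/-- **U♭ FOR EVERY DISCRETE `P` OF `U(Φ₃)`, MODULO EXACTLY 12R3** (`R(f)|_{L²_res}` compact: ★-typed `CmResidualSpectrumCompactR L 3 μ`, E1's live socket; finite component by ★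
`exists_irreducible_admissible_hasFinComponent_qs_of_residualCompactR`). [cite: Rogawski1990, Thm. 13.3.5 p. 202; §14.6 p. 244] [cite: MoeglinWaldspurger1995, I.2.18 and V.3.13] -/
theorem memXiFamily_rigid_qs_of_residualCompactR (hR : @K2E1CuspidalSpectrumUnitary.CmResidualSpectrumCompactR L _ _ _ 3 μq hμq)
    (P : DiscreteAutomorphicRep (adelicGroupData (↥(maximalRealSubfield L)) L (IsCMField.complexConj L) 3 (qsForm L)) μq)
    (ξ ξ' : OneDimAutRepH L) (h : MemXiFamily P hHq hHdq μω hμu ξ) (h' : MemXiFamily P hHq hHdq μω hμu ξ') : ξ = ξ' := by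
  obtain ⟨W, _, _, σ, hirr, hadm, hPσ⟩ := @exists_irreducible_admissible_hasFinComponent_qs_of_residualCompactR L _ _ _ μq hμq hR P
  exact memXiFamily_rigid_of_hasFinComponent_adm L (qsForm L) hHq hHdq μq μω hμu P hirr hadm hPσ ξ ξ' h h'

end QuasiSplit

end Summit.HodgeConjecture.HodgeConjecture.R90.S5

end
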